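import Summits.BirchSwinnertonDyer.BirchSwinnertonDyer.Theorems.ManinLocalTwoThreeStevensCurveRatPresentationDatum
import Summits.BirchSwinnertonDyer.BirchSwinnertonDyer.Theorems.ManinLocalTwoThreeStevensCurveYPresentation
import Summits.BirchSwinnertonDyer.BirchSwinnertonDyer.Theorems.ManinLocalTwoThreeCuspValuesOfTranslatesGamma1
import Summits.BirchSwinnertonDyer.BirchSwinnertonDyer.Theorems.ManinLocalTwoThreeExistsMinimalOptimalDatum
import Literature.NumberTheory.EllipticCurves.Gamma1ParametrizationCuspGaloisAction
import HarnessLib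

/-!
# T-es-75 (Stevens 1982 Thm 1.3.1 (b)) ⟸ modularity ∧ «Shimura reciprocity on translates» — the ASSEMBLY of the discharge road
(route `ManinLocalTwoThree`, crux C2 stmt-BirchSwinnertonDyer-22967; cell bsd-f2-manin, prover p3 gen 21; joint road: step (0) p3 = rational
`Γ₁(N)`-presentations of `x∘φ₁, y∘φ₁` on the Stevens curve; step (1) LEAD p1 = Galois action on `q_N`-expansions of translates (`qExpansion_slash_conj`,
written, pending farm oleans); step (2) p2 = cusp values as leading coefficients (`CuspValues.*`))

STEP (1) enters as an EXPLICIT HYPOTHESIS `hSC` (no definition is introduced), in the currency of p2's `CuspValues` lemmas: for every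
`F ∈ S_k(Γ₁(N))` with RATIONAL Fourier coefficients at `∞`, every `σ ∈ Aut(ℂ/ℚ)` with `σ(e^{2πi/N}) = e^{2πid/N}`, `dd′ ≡ 1 (N)`, and all
`g, g′ ∈ SL₂(ℤ)` with `g′ = (a, db; d′c, δ)` where `g = (a, b; c, δ)` (exact entries; the special case of `g′ ≡ diag(1,d)⁻¹ g diag(1,d) (mod N)` that
the cusps `1/y ↦ 1/(d′y)` need), the `q_N`-coefficients satisfy `coeff_n(F ∣ g′) = σ(coeff_n(F ∣ g))`.  From it:

* `stevensFormula_of_gamma1Datum_one_of_slashConj` — **Stevens' formula `σ(π(c{∞,1/y})) = π(c{∞,1/(d′y)})` for every `X₁(N)`-datum with `c = 1`**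
  (in particular the Stevens datum of `…StevensCurveDatum`): the `x`- and `y`-coordinates of `P_{g∞} = π({∞,g∞})` are ratios of `q_N`-coefficients
  of the translates of the RATIONAL presenting forms `(F₁, G₁)`, `(Fʸ, Gʸ)` (`StevensCurve.exists_rat_gamma1_presentation_of_gamma1Datum_one`,
  `exists_gamma1_yPresentation`; p2's `CuspValues.coeff_slash_eq_weierstrassP_mul` / `…derivWeierstrassP_mul` / `mem_lattice_iff_exists_coeff_ne_zero`)
  at `g = (1 0; y 1)` and `g′ = (1 0; d′y 1)`; `hSC` transports them (and the case `P = O`);  `N = 1` is the degenerate case `Γ₁(1) = SL₂(ℤ)`;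
* `optimalTwinOne_of_modularity` — every `X₁(N)`-datum has an OPTIMAL twin with `c = 1` and the same newform (EXO ⟸ modularity + the Stevens curve);
* `naturalTes75_of_modularity_slashConj` — **T-es-75♮ (Stevens (b) for EVERY `X₁(N)`-datum, no optimality) ⟸ modularity ∧ hSC** (p2's bridge run
  with the `c = 1` twins: `ℚ`-isogeny `ψ(π₁ z) = π(cz)`, `Isogeny.map_baseChange`);
* `Tes75_of_modularity_slashConj` — **the tree's printed fact `optimalGamma1Parametrization_cuspInv_galoisAction` ⟸ modularity ∧ hSC.**

So when the LEAD's `qExpansion_slash_conj` lands, T-es-75 is a theorem modulo modularity, and with it (p2/p3 consumers): the Derickx–Orlić cyclicity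
rows ⟸ modularity ALONE, the rung `ManinConstantOne` ⟸ {modularity, CDT}, C2 ⟸ CDT.  HONEST FRAMING: CONDITIONAL on the binder `hSC` (not yet a
tree theorem) and on modularity; nothing about C2/C3, Manin's conjecture or BSD is proved here.
[cite: Stevens1982, §1.3 Thm. 1.3.1 (b)] [cite: ShimuraIATAF1971, §6.1–6.2, Prop. 6.9] [cite: Manin1972, Prop. 1.4 and §1.5] [cite: SilvermanAEC2009, Thm. VI.4.1]
-/

set_option autoImplicit false
-- lint-debt: the directory name repeats the summit name (sibling precedent `ManinLocalTwoThreeStevensCurveRatPresentationDatum.lean`)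
set_option linter.dupNamespace false

noncomputable section

open scoped MatrixGroups PeriodPair ModularForm UpperHalfPlane
open Complex Filter Function CongruenceSubgroup PowerSeries
open UpperHalfPlane hiding I
open WeierstrassCurve
open Literature.NumberTheory.EllipticCurves Literature.NumberTheory.EllipticCurves.ModularForms

namespace Summit.BirchSwinnertonDyer.BirchSwinnertonDyer.Theorems.ManinLocalTwoThree.StevensCurve

variable {N : ℕ} [NeZero N]

/-! ### Small helpers -/

omit [NeZero N] in
/-- The cusp value at a `Γ₁(N)`-cusp of the form `g∞`, `g ∈ Γ₁(N)`, lies in `Λ₁(f)`. [cite: Manin1972, Prop. 1.4] -/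
theorem modularSymbol_mem_periodLatticeGamma1_of_mem (f : CuspForm (Gamma0 N) 2) (g : SL(2, ℤ)) (hg : g ∈ Gamma1 N)
    (hg10 : (g 1 0 : ℤ) ≠ 0) :
    modularSymbol f (((g 0 0 : ℤ) : ℚ) / ((g 1 0 : ℤ) : ℚ)) ∈ periodLatticeGamma1 f := by
  have h := cuspSymbol_mem_periodLatticeGamma1 f ⟨g, hg⟩
  rwa [cuspSymbol, if_neg (by exact hg10)] at h

/-- First non-vanishing coefficient: a nonzero power series has a least index with nonzero coefficient. [folklore] -/
theorem exists_first_coeff_ne_zero {A : ℂ⟦X⟧} (hA : A ≠ 0) :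
    ∃ m : ℕ, coeff m A ≠ 0 ∧ ∀ n < m, coeff n A = 0 := by
  classical
  have hex : ∃ n, coeff n A ≠ 0 := by
    by_contra h
    exact hA (PowerSeries.ext fun n ↦ by rw [map_zero]; exact not_not.mp (not_exists.mp h n))
  refine ⟨Nat.find hex, Nat.find_spec hex, fun n hn ↦ ?_⟩
  by_contra h
  exact Nat.find_min hex hn h

omit [NeZero N] in
/-- A translate of a nonzero cusp form on `Γ₁(N)` is a nonzero function. [folklore] -/
theorem slash_ne_zero_of_ne_zero {k : ℤ} (G : CuspForm (Gamma1 N) k) (hG : G ≠ 0) (g : SL(2, ℤ)) : (⇑G ∣[k] g) ≠ 0 := by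
  intro h0
  apply hG
  apply DFunLike.ext
  intro τ
  have h1 : (⇑G : ℍ → ℂ) = ((⇑G ∣[k] g) ∣[k] g⁻¹) := by rw [← SlashAction.slash_mul, mul_inv_cancel, SlashAction.slash_one]
  have h2 := congrFun h1 τ
  rw [h0, SlashAction.zero_slash] at h2
  simpa using h2

/-- The `q_N`-expansion of a translate of a nonzero cusp form on `Γ₁(N)` is nonzero. [folklore] -/
theorem qExpansion_slash_ne_zero {k : ℤ} (G : CuspForm (Gamma1 N) k) (hG : G ≠ 0) (g : SL(2, ℤ)) :
    qExpansion ((N : ℕ) : ℝ) (⇑G ∣[k] g) ≠ 0 := by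
  have hφ := isCuspFunction_slash_gamma1 G g
  rw [Ne, UpperHalfPlane.qExpansion_eq_zero_iff hφ.pos hφ.periodic hφ.mdifferentiable hφ.isBoundedAtImInfty]
  exact slash_ne_zero_of_ne_zero G hG g

/-! ### Stevens' formula for `X₁(N)`-data of Manin constant `1`, modulo Shimura reciprocity on translates -/

/-- **Stevens' formula for every `X₁(N)`-datum of Manin constant `1`, modulo step (1).**  Let `hSC` be the Galois law on `q_N`-coefficients of
translates of rational cusp forms on `Γ₁(N)` (the LEAD's step (1), explicit hypothesis).  Then for every elliptic `W/ℚ`, every `X₁(N)`-datum `D` of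
`W` with `D.c = 1`, every `σ ∈ Aut(ℂ/ℚ)` with `σ(e^{2πi/N}) = e^{2πid/N}`, `dd′ ≡ 1 (N)`, and `y ≠ 0`:
`σ(π(c·{∞,1/y}_f)) = π(c·{∞,1/(d′y)}_f)`.  CONDITIONAL on `hSC`. [cite: Stevens1982, §1.3 Thm. 1.3.1 (b)] [cite: ShimuraIATAF1971, Prop. 6.9]
[cite: Manin1972, §1.5] -/
theorem stevensFormula_of_gamma1Datum_one_of_slashConj
    (hSC : ∀ (k : ℤ) (F : CuspForm (Gamma1 N) k), (∀ n, ∃ q : ℚ, (q : ℂ) = cuspCoeff F n) →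
      ∀ (σ : ℂ ≃ₐ[ℚ] ℂ) (d d' : ℤ), ((d * d' : ℤ) : ZMod N) = 1 →
      σ (Complex.exp (2 * Real.pi * Complex.I / N)) = Complex.exp (2 * Real.pi * Complex.I * d / N) →
      ∀ (g g' : SL(2, ℤ)), (g' 0 0 : ℤ) = g 0 0 → (g' 1 1 : ℤ) = g 1 1 → (g' 0 1 : ℤ) = d * g 0 1 → (g' 1 0 : ℤ) = d' * g 1 0 →
      ∀ n, (qExpansion ((N : ℕ) : ℝ) (⇑F ∣[k] g')).coeff n = σ ((qExpansion ((N : ℕ) : ℝ) (⇑F ∣[k] g)).coeff n))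
    {W : WeierstrassCurve ℚ} [W.IsElliptic] (D : Gamma1ParametrizationData W N) (hc : D.c = 1)
    (σ : ℂ ≃ₐ[ℚ] ℂ) (d d' : ℤ) (hdd' : ((d * d' : ℤ) : ZMod N) = 1)
    (hσ : σ (Complex.exp (2 * Real.pi * Complex.I / N)) = Complex.exp (2 * Real.pi * Complex.I * d / N))
    (y : ℤ) (hy : y ≠ 0) :
    Affine.Point.map (W' := W) (σ : ℂ →ₐ[ℚ] ℂ) (D.uniformize ((D.c : ℂ) * modularSymbol D.f (1 / y))) =
      D.uniformize ((D.c : ℂ) * modularSymbol D.f (1 / (d' * y))) := by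
  classical
  have hf : D.f ≠ 0 := D.isNewformOf.1.ne_zero
  have hker : ∀ z, D.uniformize z = 0 ↔ z ∈ D.L.lattice := fun z ↦ by
    rw [← SetLike.mem_coe, ← D.ker_uniformize, SetLike.mem_coe, AddMonoidHom.mem_ker]
  have hΛ₁ : ∀ z ∈ periodLatticeGamma1 D.f, z ∈ D.L.lattice := fun z hz ↦ by
    have h := D.smul_periodLatticeGamma1_le z hz
    rwa [hc, Int.cast_one, one_mul] at h
  rw [hc, Int.cast_one, one_mul, one_mul]
  -- the matrices `g = (1 0; y 1)`, `g' = (1 0; d'y 1)`, `S = (0 -1; 1 0)`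
  let g : SL(2, ℤ) := ⟨!![1, 0; y, 1], by simp [Matrix.det_fin_two_of]⟩
  let g' : SL(2, ℤ) := ⟨!![1, 0; d' * y, 1], by simp [Matrix.det_fin_two_of]⟩
  have hg00 : (g 0 0 : ℤ) = 1 := rfl
  have hg10 : (g 1 0 : ℤ) = y := rfl
  have hg01 : (g 0 1 : ℤ) = 0 := rfl
  have hg11 : (g 1 1 : ℤ) = 1 := rfl
  have hg'00 : (g' 0 0 : ℤ) = 1 := rfl
  have hg'10 : (g' 1 0 : ℤ) = d' * y := rfl
  have hg'01 : (g' 0 1 : ℤ) = 0 := rfl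
  have hg'11 : (g' 1 1 : ℤ) = 1 := rfl
  have hgq : ((g 0 0 : ℤ) : ℚ) / ((g 1 0 : ℤ) : ℚ) = 1 / (y : ℚ) := by rw [hg00, hg10, Int.cast_one]
  have hg'q : ((g' 0 0 : ℤ) : ℚ) / ((g' 1 0 : ℤ) : ℚ) = 1 / ((d' : ℚ) * (y : ℚ)) := by rw [hg'00, hg'10, Int.cast_one, Int.cast_mul]
  -- the degenerate level `N = 1`: every cusp value vanishes
  by_cases hN : N = 1
  · subst hN
    have hmem : ∀ γ : SL(2, ℤ), γ ∈ Gamma1 1 := fun γ ↦ by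
      rw [Gamma1_mem]
      exact ⟨Subsingleton.elim _ _, Subsingleton.elim _ _, Subsingleton.elim _ _⟩
    have hval : ∀ γ : SL(2, ℤ), (γ 1 0 : ℤ) ≠ 0 →
        D.uniformize (modularSymbol D.f (((γ 0 0 : ℤ) : ℚ) / ((γ 1 0 : ℤ) : ℚ))) = 0 := fun γ hγ ↦
      (hker _).mpr (hΛ₁ _ (modularSymbol_mem_periodLatticeGamma1_of_mem D.f γ (hmem γ) hγ))
    have h1 : D.uniformize (modularSymbol D.f (1 / (y : ℚ))) = 0 := by
      rw [← hgq]; exact hval g (by rw [hg10]; exact hy)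
    have h2 : D.uniformize (modularSymbol D.f (1 / ((d' : ℚ) * (y : ℚ)))) = 0 := by
      by_cases hd' : d' * y = 0
      · -- `1/0 = 0 = S∞`
        let S : SL(2, ℤ) := ⟨!![0, -1; 1, 0], by simp [Matrix.det_fin_two_of]⟩
        have hd'q : (d' : ℚ) * (y : ℚ) = 0 := by exact_mod_cast hd'
        have hS : ((S 0 0 : ℤ) : ℚ) / ((S 1 0 : ℤ) : ℚ) = 1 / ((d' : ℚ) * (y : ℚ)) := by
          rw [hd'q, show (S 0 0 : ℤ) = 0 from rfl, show (S 1 0 : ℤ) = 1 from rfl]; simp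
        rw [← hS]; exact hval S (by rw [show (S 1 0 : ℤ) = 1 from rfl]; exact one_ne_zero)
      · rw [← hg'q]; exact hval g' (by rw [hg'10]; exact hd')
    rw [h1, h2, Affine.Point.map_zero]
  -- `N ≠ 1`: `d' ≠ 0`
  have hd' : d' ≠ 0 := by
    rintro rfl
    apply hN
    rw [mul_zero, Int.cast_zero] at hdd'
    have h1 : (1 : ZMod N).val = 0 := by rw [← hdd', ZMod.val_zero]
    rw [ZMod.val_one_eq_one_mod] at h1
    exact Nat.dvd_one.mp (Nat.dvd_of_mod_eq_zero h1)
  have hg10' : (g 1 0 : ℤ) ≠ 0 := by rw [hg10]; exact hy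
  have hg'10' : (g' 1 0 : ℤ) ≠ 0 := by rw [hg'10]; exact mul_ne_zero hd' hy
  -- the rational presentations of `x` and `y`
  obtain ⟨k, F₁, G₁, -, hG₁, hFG, hF₁r, hG₁r⟩ := exists_rat_gamma1_presentation_of_gamma1Datum_one D hc
  have hfr : ∀ n, ∃ q : ℚ, (q : ℂ) = cuspCoeff D.f n := fun n ↦
    ⟨(W.LFunction n : ℚ), by rw [D.isNewformOf.2 n, Rat.cast_intCast]⟩
  obtain ⟨Fy, Gy, hGy, hFGy, -, -, hrat⟩ := exists_gamma1_yPresentation D.f hf D.L F₁ G₁ hG₁ hFG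
  obtain ⟨hFyr, hGyr⟩ := hrat hF₁r hG₁r hfr
  have hpres : ∀ τ : ℍ, (1 : ℂ) * eichlerIntegral D.f τ ∉ D.L.lattice → G₁ τ * ℘[D.L] ((1 : ℂ) * eichlerIntegral D.f τ) = F₁ τ := by
    intro τ hτ; rw [one_mul] at hτ ⊢; rw [mul_comm]; exact hFG τ hτ
  have hpresy : ∀ τ : ℍ, (1 : ℂ) * eichlerIntegral D.f τ ∉ D.L.lattice → Gy τ * ℘'[D.L] ((1 : ℂ) * eichlerIntegral D.f τ) = Fy τ := by
    intro τ hτ; rw [one_mul] at hτ ⊢; rw [mul_comm]; exact hFGy τ hτ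
  -- the Galois law on the four forms
  have hSC' : ∀ {k : ℤ} (F : CuspForm (Gamma1 N) k), (∀ n, ∃ q : ℚ, (q : ℂ) = cuspCoeff F n) →
      ∀ n, (qExpansion ((N : ℕ) : ℝ) (⇑F ∣[k] g')).coeff n = σ ((qExpansion ((N : ℕ) : ℝ) (⇑F ∣[k] g)).coeff n) :=
    fun F hF ↦ hSC _ F hF σ d d' hdd' hσ g g' (by rw [hg'00, hg00]) (by rw [hg'11, hg11])
      (by rw [hg'01, hg01, mul_zero]) (by rw [hg'10, hg10])
  -- first non-vanishing coefficients of `G₁ ∣ g`, `Gʸ ∣ g`, and their transport to `g'`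
  obtain ⟨m, hGm, hGlt⟩ := exists_first_coeff_ne_zero (qExpansion_slash_ne_zero G₁ hG₁ g)
  obtain ⟨m', hGym, hGylt⟩ := exists_first_coeff_ne_zero (qExpansion_slash_ne_zero Gy hGy g)
  have hGm' : (qExpansion ((N : ℕ) : ℝ) (⇑G₁ ∣[k] g')).coeff m ≠ 0 := by
    rw [hSC' G₁ hG₁r m]; exact (map_ne_zero σ).mpr hGm
  have hGlt' : ∀ n < m, (qExpansion ((N : ℕ) : ℝ) (⇑G₁ ∣[k] g')).coeff n = 0 := fun n hn ↦ by
    rw [hSC' G₁ hG₁r n, hGlt n hn, map_zero]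
  have hGym' : (qExpansion ((N : ℕ) : ℝ) (⇑Gy ∣[k + (k + 2)] g')).coeff m' ≠ 0 := by
    rw [hSC' Gy hGyr m']; exact (map_ne_zero σ).mpr hGym
  have hGylt' : ∀ n < m', (qExpansion ((N : ℕ) : ℝ) (⇑Gy ∣[k + (k + 2)] g')).coeff n = 0 := fun n hn ↦ by
    rw [hSC' Gy hGyr n, hGylt n hn, map_zero]
  -- the two cusp values `z₀ = {∞, 1/y}`, `z₀' = {∞, 1/(d'y)}`
  set z₀ : ℂ := (1 : ℂ) * modularSymbol D.f (((g 0 0 : ℤ) : ℚ) / ((g 1 0 : ℤ) : ℚ)) with hz₀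
  set z₀' : ℂ := (1 : ℂ) * modularSymbol D.f (((g' 0 0 : ℤ) : ℚ) / ((g' 1 0 : ℤ) : ℚ)) with hz₀'
  have hgoal₁ : modularSymbol D.f (1 / (y : ℚ)) = z₀ := by rw [hz₀, one_mul, hgq]
  have hgoal₂ : modularSymbol D.f (1 / ((d' : ℚ) * (y : ℚ))) = z₀' := by rw [hz₀', one_mul, hg'q]
  rw [hgoal₁, hgoal₂]
  -- vanishing is transported
  have hiff := CuspValues.mem_lattice_iff_exists_coeff_ne_zero D.f hf D.L F₁ G₁ one_ne_zero hpres g hg10' hGm hGlt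
  have hiff' := CuspValues.mem_lattice_iff_exists_coeff_ne_zero D.f hf D.L F₁ G₁ one_ne_zero hpres g' hg'10' hGm' hGlt'
  by_cases hmem : z₀ ∈ D.L.lattice
  · have hmem' : z₀' ∈ D.L.lattice := by
      obtain ⟨n, hn, hne⟩ := hiff.mp hmem
      exact hiff'.mpr ⟨n, hn, by rw [hSC' F₁ hF₁r n]; exact (map_ne_zero σ).mpr hne⟩
    rw [(hker _).mpr hmem, (hker _).mpr hmem', Affine.Point.map_zero]
  · have hmem' : z₀' ∉ D.L.lattice := by
      intro h'
      obtain ⟨n, hn, hne⟩ := hiff'.mp h'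
      rw [hSC' F₁ hF₁r n] at hne
      exact hmem (hiff.mpr ⟨n, hn, fun h0 ↦ hne (by rw [h0, map_zero])⟩)
    -- coordinates as coefficient ratios
    have hx := (CuspValues.coeff_slash_eq_weierstrassP_mul D.f hf D.L F₁ G₁ one_ne_zero hpres g hg10' hmem hGm hGlt).2
    have hx' := (CuspValues.coeff_slash_eq_weierstrassP_mul D.f hf D.L F₁ G₁ one_ne_zero hpres g' hg'10' hmem' hGm' hGlt').2
    have hyc := (CuspValues.coeff_slash_eq_derivWeierstrassP_mul D.f hf D.L Fy Gy one_ne_zero hpresy g hg10' hmem hGym hGylt).2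
    have hyc' := (CuspValues.coeff_slash_eq_derivWeierstrassP_mul D.f hf D.L Fy Gy one_ne_zero hpresy g' hg'10' hmem' hGym' hGylt').2
    have hPz : (σ : ℂ →ₐ[ℚ] ℂ) (℘[D.L] z₀) = ℘[D.L] z₀' := by
      have e1 : ℘[D.L] z₀ = (qExpansion ((N : ℕ) : ℝ) (⇑F₁ ∣[k] g)).coeff m / (qExpansion ((N : ℕ) : ℝ) (⇑G₁ ∣[k] g)).coeff m := by
        rw [eq_div_iff hGm, hx]
      have e2 : ℘[D.L] z₀' = (qExpansion ((N : ℕ) : ℝ) (⇑F₁ ∣[k] g')).coeff m / (qExpansion ((N : ℕ) : ℝ) (⇑G₁ ∣[k] g')).coeff m := by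
        rw [eq_div_iff hGm', hx']
      rw [e1, e2, hSC' F₁ hF₁r m, hSC' G₁ hG₁r m]
      change σ _ = _
      rw [map_div₀]
    have hP'z : (σ : ℂ →ₐ[ℚ] ℂ) (℘'[D.L] z₀) = ℘'[D.L] z₀' := by
      have e1 : ℘'[D.L] z₀ = (qExpansion ((N : ℕ) : ℝ) (⇑Fy ∣[k + (k + 2)] g)).coeff m' /
          (qExpansion ((N : ℕ) : ℝ) (⇑Gy ∣[k + (k + 2)] g)).coeff m' := by
        rw [eq_div_iff hGym, hyc]
      have e2 : ℘'[D.L] z₀' = (qExpansion ((N : ℕ) : ℝ) (⇑Fy ∣[k + (k + 2)] g')).coeff m' /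
          (qExpansion ((N : ℕ) : ℝ) (⇑Gy ∣[k + (k + 2)] g')).coeff m' := by
        rw [eq_div_iff hGym', hyc']
      rw [e1, e2, hSC' Fy hFyr m', hSC' Gy hGyr m']
      change σ _ = _
      rw [map_div₀]
    -- the rational Weierstrass coefficients are fixed by `σ`
    have hA₁ : (σ : ℂ →ₐ[ℚ] ℂ) (W.baseChange ℂ).a₁ = (W.baseChange ℂ).a₁ := by
      rw [show (W.baseChange ℂ).a₁ = (W.a₁ : ℂ) by simp [WeierstrassCurve.baseChange, WeierstrassCurve.map_a₁]]
      exact map_ratCast _ _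
    have hA₃ : (σ : ℂ →ₐ[ℚ] ℂ) (W.baseChange ℂ).a₃ = (W.baseChange ℂ).a₃ := by
      rw [show (W.baseChange ℂ).a₃ = (W.a₃ : ℂ) by simp [WeierstrassCurve.baseChange, WeierstrassCurve.map_a₃]]
      exact map_ratCast _ _
    have hB₂ : (σ : ℂ →ₐ[ℚ] ℂ) (W.baseChange ℂ).b₂ = (W.baseChange ℂ).b₂ := by
      rw [show (W.baseChange ℂ).b₂ = (W.b₂ : ℂ) by simp [WeierstrassCurve.baseChange, WeierstrassCurve.map_b₂]]
      exact map_ratCast _ _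
    have h2 : (σ : ℂ →ₐ[ℚ] ℂ) 2 = 2 := map_ofNat _ 2
    have h12 : (σ : ℂ →ₐ[ℚ] ℂ) 12 = 12 := map_ofNat _ 12
    obtain ⟨n₀, hspec⟩ := D.uniformize_spec z₀ hmem
    obtain ⟨n₀', hspec'⟩ := D.uniformize_spec z₀' hmem'
    rw [hspec, hspec', Affine.Point.map_some, Affine.Point.some.injEq]
    refine ⟨?_, ?_⟩
    · simp only [map_sub, map_div₀, hB₂, h12, hPz]
    · simp only [map_sub, map_mul, map_div₀, hA₁, hA₃, hB₂, h2, h12, hPz, hP'z]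

/-! ### Optimal twins of Manin constant `1` (EXO ⟸ modularity + the Stevens curve) -/

/-- **Every `X₁(N)`-datum has an OPTIMAL twin with Manin constant `1` and the same newform**, on some elliptic curve over `ℚ`: `X₁(N)`-datum ⟹
`X₀(N)`-datum of the same curve (p2 `NaturalTes75.exists_modularParametrizationData_of_gamma1`) ⟹ lattice-optimal datum of a globally minimal curve (EXO,
es g40, ⟸ modularity) ⟹ the Stevens curve `ℂ/Λ₁(f)` with its optimal datum, `c = 1` (`exists_optimal_gamma1ParametrizationData_one`).  CONDITIONAL on
modularity. [cite: Stevens1989, §2] [cite: DiamondShurman2005, Thm. 8.8.3] -/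
theorem optimalTwinOne_of_modularity (hnf : exists_isNewformOf) (W : WeierstrassCurve ℚ) [W.IsElliptic] (D : Gamma1ParametrizationData W N) :
    ∃ (E₁ : WeierstrassCurve ℚ) (_ : E₁.IsElliptic) (D₁ : Gamma1ParametrizationData E₁ N), D₁.IsOptimal ∧ D₁.c = 1 ∧ D₁.f = D.f := by
  obtain ⟨D', hf', -, -⟩ := NaturalTes75.exists_modularParametrizationData_of_gamma1 D
  obtain ⟨W₀, _, _, D₀, hf₀, hopt⟩ := ExistsMinimalOptimalDatum.existsMinimalOptimalDatum_of_modularity hnf W D'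
  obtain ⟨E₁, hE₁, D₁, hf₁, hc₁, hD₁, -, -⟩ := exists_optimal_gamma1ParametrizationData_one D₀ hopt
  exact ⟨E₁, hE₁, D₁, hD₁, hc₁, by rw [hf₁, hf₀, hf']⟩

/-! ### T-es-75♮ and T-es-75 modulo modularity ∧ Shimura reciprocity on translates -/

/-- **T-es-75♮ ⟸ modularity ∧ step (1)**: Stevens' formula `σ(π(c{∞,1/y})) = π(c{∞,1/(d′y)})` for EVERY `X₁(N)`-datum of every elliptic `W/ℚ` (no
optimality).  Proof: Stevens' formula on the optimal twin of Manin constant `1` (`stevensFormula_of_gamma1Datum_one_of_slashConj`), pushed through the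
`ℚ`-isogeny `ψ : E₁ → W`, `ψ(π₁ z) = π(c z)`, of the lattice inclusion `c·Λ(D₁.L) = cΛ₁(f) ⊆ Λ_W` (p2 gen 23's bridge, `Isogeny.map_baseChange`).
CONDITIONAL on modularity and `hSC`. [cite: Stevens1982, §1.3 Thm. 1.3.1 (b)] [cite: SilvermanAEC2009, Thm. VI.4.1] -/
theorem naturalTes75_of_modularity_slashConj (hnf : exists_isNewformOf)
    (hSC : ∀ (k : ℤ) (F : CuspForm (Gamma1 N) k), (∀ n, ∃ q : ℚ, (q : ℂ) = cuspCoeff F n) →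
      ∀ (σ : ℂ ≃ₐ[ℚ] ℂ) (d d' : ℤ), ((d * d' : ℤ) : ZMod N) = 1 →
      σ (Complex.exp (2 * Real.pi * Complex.I / N)) = Complex.exp (2 * Real.pi * Complex.I * d / N) →
      ∀ (g g' : SL(2, ℤ)), (g' 0 0 : ℤ) = g 0 0 → (g' 1 1 : ℤ) = g 1 1 → (g' 0 1 : ℤ) = d * g 0 1 → (g' 1 0 : ℤ) = d' * g 1 0 →
      ∀ n, (qExpansion ((N : ℕ) : ℝ) (⇑F ∣[k] g')).coeff n = σ ((qExpansion ((N : ℕ) : ℝ) (⇑F ∣[k] g)).coeff n))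
    (W : WeierstrassCurve ℚ) [W.IsElliptic] (D : Gamma1ParametrizationData W N)
    (σ : ℂ ≃ₐ[ℚ] ℂ) (d d' : ℤ) (hdd' : ((d * d' : ℤ) : ZMod N) = 1)
    (hσ : σ (Complex.exp (2 * Real.pi * Complex.I / N)) = Complex.exp (2 * Real.pi * Complex.I * d / N))
    (y : ℤ) (hy : y ≠ 0) :
    Affine.Point.map (W' := W) (σ : ℂ →ₐ[ℚ] ℂ) (D.uniformize ((D.c : ℂ) * modularSymbol D.f (1 / y))) =
      D.uniformize ((D.c : ℂ) * modularSymbol D.f (1 / (d' * y))) := by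
  obtain ⟨E₁, hE₁, D₁, hD₁, hc₁, hf⟩ := optimalTwinOne_of_modularity hnf W D
  haveI := hE₁
  -- Stevens' formula on the twin
  have hK := stevensFormula_of_gamma1Datum_one_of_slashConj hSC D₁ hc₁ σ d d' hdd' hσ y hy
  rw [hf, hc₁, Int.cast_one, one_mul, one_mul] at hK
  -- the `ℚ`-isogeny `z ↦ c z` (adapted verbatim from p2 gen 23's `naturalTes75_of_Tes75_of_optimalTwin`)
  have hc : D.c ≠ 0 := D.maninConstant_ne_zero
  have hr0 : (D.c : ℚ) ≠ 0 := by exact_mod_cast hc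
  have hle : ∀ z ∈ D₁.L.lattice, ((D.c : ℚ) : ℂ) * z ∈ D.L.lattice := by
    intro z hz
    obtain ⟨w, hw, hzw⟩ := hD₁ z hz
    rw [hf] at hw
    rw [hzw, hc₁, Int.cast_one, one_mul, Rat.cast_intCast]
    exact D.smul_periodLatticeGamma1_le w hw
  haveI : Algebra.IsAlgebraic ℚ (AlgebraicClosure ℚ) := AlgebraicClosure.isAlgebraic ℚ
  haveI : IsAlgClosure ℚ (AlgebraicClosure ℚ) := AlgebraicClosure.instIsAlgClosure ℚ
  haveI : Normal ℚ (AlgebraicClosure ℚ) := IsAlgClosure.normal ℚ (AlgebraicClosure ℚ)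
  letI : Algebra (AlgebraicClosure ℚ) ℂ := (IsAlgClosed.lift : AlgebraicClosure ℚ →ₐ[ℚ] ℂ).toRingHom.toAlgebra
  haveI : IsScalarTower ℚ (AlgebraicClosure ℚ) ℂ := IsScalarTower.of_algebraMap_eq' (Subsingleton.elim _ _)
  obtain ⟨ψ, hψ, -, -⟩ := exists_isogeny_baseChange_apply_eq_of_forall_mul_mem_lattice
    D₁.isNeronLattice.1 D₁.isNeronLattice.2 D.isNeronLattice.1 D.isNeronLattice.2
    D₁.ker_uniformize D₁.uniformize_surjective D₁.uniformize_spec D.ker_uniformize D.uniformize_spec hr0 hle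
  -- Galois equivariance of `ψ_ℂ`
  set τ₀ : AlgebraicClosure ℚ ≃ₐ[ℚ] AlgebraicClosure ℚ := σ.restrictNormal (AlgebraicClosure ℚ) with hτ₀
  have hστ : ∀ a : AlgebraicClosure ℚ, (σ : ℂ →ₐ[ℚ] ℂ) (algebraMap (AlgebraicClosure ℚ) ℂ a) =
      algebraMap (AlgebraicClosure ℚ) ℂ (Field.absoluteGaloisGroup.toAlgEquiv ℚ ((Field.absoluteGaloisGroup.toAlgEquiv ℚ).symm τ₀) a) := by
    intro a
    rw [MulEquiv.apply_symm_apply, hτ₀]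
    exact (AlgEquiv.restrictNormal_commutes σ (AlgebraicClosure ℚ) a).symm
  have hequiv : ∀ P : (E₁.baseChange ℂ).toAffine.Point,
      Affine.Point.map (W' := W) (σ : ℂ →ₐ[ℚ] ℂ) (ψ.baseChange (M := ℂ) P) =
        ψ.baseChange (M := ℂ) (Affine.Point.map (W' := E₁) (σ : ℂ →ₐ[ℚ] ℂ) P) :=
    fun P ↦ ψ.map_baseChange (σ : ℂ →ₐ[ℚ] ℂ) ((Field.absoluteGaloisGroup.toAlgEquiv ℚ).symm τ₀) hστ P
  -- push Stevens' formula through `ψ_ℂ`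
  have hK' := congrArg (ψ.baseChange (M := ℂ)) hK
  rw [← hequiv, hψ, hψ, Rat.cast_intCast] at hK'
  exact hK'

/-- **T-es-75 = `optimalGamma1Parametrization_cuspInv_galoisAction` (Stevens 1982 Thm 1.3.1 (b), the tree's printed fact) ⟸ modularity ∧ step (1)**
(the Galois law on `q_N`-coefficients of translates of rational cusp forms on `Γ₁(N)`, assumed at every level `N ≥ 1`).  CONDITIONAL on both binders;
with the LEAD's `qExpansion_slash_conj` this becomes T-es-75 ⟸ modularity.  BSD is not proved; C2 stays OPEN as filed. [cite: Stevens1982, §1.3 Thm. 1.3.1 (b)] -/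
theorem Tes75_of_modularity_slashConj (hnf : exists_isNewformOf)
    (hSC : ∀ (N : ℕ) [NeZero N] (k : ℤ) (F : CuspForm (Gamma1 N) k), (∀ n, ∃ q : ℚ, (q : ℂ) = cuspCoeff F n) →
      ∀ (σ : ℂ ≃ₐ[ℚ] ℂ) (d d' : ℤ), ((d * d' : ℤ) : ZMod N) = 1 →
      σ (Complex.exp (2 * Real.pi * Complex.I / N)) = Complex.exp (2 * Real.pi * Complex.I * d / N) →
      ∀ (g g' : SL(2, ℤ)), (g' 0 0 : ℤ) = g 0 0 → (g' 1 1 : ℤ) = g 1 1 → (g' 0 1 : ℤ) = d * g 0 1 → (g' 1 0 : ℤ) = d' * g 1 0 →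
      ∀ n, (qExpansion ((N : ℕ) : ℝ) (⇑F ∣[k] g')).coeff n = σ ((qExpansion ((N : ℕ) : ℝ) (⇑F ∣[k] g)).coeff n)) :
    optimalGamma1Parametrization_cuspInv_galoisAction := by
  intro W _ N _ D _ σ d d' hdd' hσ y hy
  exact naturalTes75_of_modularity_slashConj hnf (hSC N) W D σ d d' hdd' hσ y hy

end Summit.BirchSwinnertonDyer.BirchSwinnertonDyer.Theorems.ManinLocalTwoThree.StevensCurve

end
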